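import Summits.ResolutionOfSingularities.ResolutionOfSingularities.Theorems.HomologicalConductorNoZenoRFactorStepFibre
import Summits.ResolutionOfSingularities.ResolutionOfSingularities.Theorems.HomologicalConductorNoZenoMinResolutionFewest
import Literature.AlgebraicGeometry.Resolution.ExceptionalLocusPurity
import Literature.AlgebraicGeometry.Resolution.BirationalLocalIso
import Literature.AlgebraicGeometry.Resolution.ExceptionalCurvesLocalizedResolution
import Literature.AlgebraicGeometry.Resolution.ResolutionWithoutExceptionalCurves
import Literature.AlgebraicGeometry.Resolution.ResolutionClosedPointCartier
import Literature.AlgebraicGeometry.Resolution.Lipman1969H1Domination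
import Literature.AlgebraicGeometry.Resolution.StalkIdealLemmas
import HarnessLib

/-!
# Crux `NoZenoR` (stmt-ResolutionOfSingularities-19943) — the NON-ISOMORPHISM LOCUS of a morphism between two
# desingularizations of a surface singularity (Brick (i) of the first-kind clause (F) / Stacks 0C5R)

Route `ResolutionOfSingularities/HomologicalConductor` (cell decomp-res, hand leafhand-res-homologicalconduct-18 g1).
OURS: AI-written proof over tree theorems, weaker than expert review; nothing here is a statement of the manuscript
under review (Hironaka 2017).  SUPPORT level, counted 0.  Def-free, no new named facts.

Let `S` be a two-dimensional Noetherian local normal domain, `ρ : Y → Spec S` and `π = h ≫ ρ : X → Spec S` two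
desingularizations (`IsResolution`) and `h : X → Y` the comparison morphism.  If `h` is NOT an isomorphism, there is a
CLOSED point `y ∈ Y` over the closed point of `S`, with `dim 𝒪_{Y,y} = 2`, such that NO point of the fibre `h⁻¹(y)` has
a surjective `h♯` (so `𝔪_y·𝒪_X` is invertible and `h` factors through the blowing up of `Y` at `y`, hand 18's
FactorStep′ `…Lipman12B.exists_fac_blowup_point_of_forall_not_surjective'`), `𝔪_y·𝒪_X ≠ 0`, and an integral exceptional
curve of `π` is contracted onto `y` (`exists_closedPoint_of_not_isIso`; packaged with the factorisation as
`exists_fac_blowup_point_of_not_isIso`).  Route of proof: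

* van der Waerden purity (tree `isIso_of_isProper_of_isBirational_of_forall_ringKrullDim_le_one`): `h` proper birational
  into the regular `Y` and not an isomorphism ⇒ some point `x` with `dim 𝒪_{X,x} ≤ 1` has non-surjective `h♯_x`;
* `y := h x` has `dim 𝒪_{Y,y} = 2`: otherwise `𝒪_{Y,y}` is a discrete valuation ring (or a field) of `K(Y) = K(X)`
  dominated by `𝒪_{X,x}`, and a valuation ring is maximal for domination (`surjective_stalkMap_of_valuationRing`, the
  tree's `surjective_of_valuationRing_of_fac`); hence `y` is closed and lies over `𝔪_S`;
* **saturation of open-immersion charts** (`mem_of_isOpenImmersion_ι_comp`): if a separated `h` from an integral `X`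
  restricts to an open immersion on an open `Ω`, then `h⁻¹(h(Ω)) = Ω` — the two `Y`-morphisms `h⁻¹(h Ω) ⇉ X` (inclusion,
  and lift through `Ω`) agree on the dense `Ω`, hence everywhere (Mathlib `ext_of_isDominant_of_isSeparated`); with
  Zariski's Main Theorem in the tree's form `exists_isOpenImmersion_of_quasiFiniteAt` this gives: a surjective `h♯_{x'}`
  at ONE point of a fibre of the birational `h` onto the normal `Y` forces isomorphic stalk maps on the WHOLE fibre
  (`isIso_stalkMap_of_surjective_stalkMap_of_base_eq`) — so no point over `y` has surjective `h♯`;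
* `𝔪_y·𝒪_X ≠ 0` since `h♯_x` is injective and `𝔪_y ≠ 0`; and `x` is the generic point of an exceptional curve of `π`
  (a closed point of the closed fibre would have a two-dimensional local ring,
  `IsResolution.ringKrullDim_stalk_eq_two_of_isClosed_of_nonempty`; `excCurvePoints π ≠ ∅` because otherwise `π` is an
  isomorphism, `IsResolution.isIso_of_closedFibre_subsingleton`, making `h♯_x` onto).

No crux or summit statement is proved here.
-/

noncomputable section

-- single-problem summit: the doubled namespace component `ResolutionOfSingularities` is forced
set_option linter.dupNamespace false

open CategoryTheory AlgebraicGeometry TopologicalSpace Topology IsLocalRing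
open Literature.AlgebraicGeometry.Resolution Literature.AlgebraicGeometry.Motives
open Summit.ResolutionOfSingularities.ResolutionOfSingularities.Theorems.NoZeno.ExcCount
open Scheme.IdealSheafData

universe u

namespace Summit.ResolutionOfSingularities.ResolutionOfSingularities.Theorems.NoZeno.FirstKind

/-! ## §1 Saturation of open-immersion charts of a separated morphism -/

section Saturation

variable {X Y : Scheme.{u}}

/-- **An open on which a separated morphism from an integral scheme restricts to an open immersion is saturated**:
if `X` is integral, `h : X → Y` is separated and `Ω ⊆ X` is an open with `Ω ↪ X → Y` an open immersion, then every point
`x` with `h x ∈ h(Ω)` lies in `Ω` (`h⁻¹(h Ω) = Ω`).  The inclusion `W = h⁻¹(h Ω) ↪ X` and the lift `W → Ω ↪ X` through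
the open immersion are two `Y`-morphisms from the reduced `W` to `X`, separated over `Y`, which agree on the dense open
`Ω ⊆ W`; so they are equal (Mathlib `ext_of_isDominant_of_isSeparated`). [cite: GortzWedhorn2020, Cor. 9.9 and Example 9.12] -/
theorem mem_of_isOpenImmersion_ι_comp [IsIntegral X] (h : X ⟶ Y) [IsSeparated h] (Ω : X.Opens)
    [hΩ : IsOpenImmersion (Ω.ι ≫ h)] {x : X} (hx : h.base x ∈ Set.range (Ω.ι ≫ h).base) : x ∈ Ω := by
  set j : (Ω : Scheme.{u}) ⟶ Y := Ω.ι ≫ h with hjdef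
  set W : X.Opens := h ⁻¹ᵁ j.opensRange with hWdef
  have hΩW : Ω ≤ W := fun ω hω => ⟨⟨ω, hω⟩, rfl⟩
  have hxW : x ∈ W := hx
  -- the lift `ℓ : W → Ω` of `W ↪ X → Y` through the open immersion `j`
  have hsub : Set.range (W.ι ≫ h).base ⊆ Set.range j.base := by
    rintro _ ⟨w, rfl⟩
    exact w.2
  let ℓ : (W : Scheme.{u}) ⟶ Ω := IsOpenImmersion.lift j (W.ι ≫ h) hsub
  have hℓ : ℓ ≫ j = W.ι ≫ h := IsOpenImmersion.lift_fac _ _ _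
  -- the two `Y`-morphisms `W ⇉ X` agree
  have heq : W.ι = ℓ ≫ Ω.ι := by
    obtain ⟨ω, -⟩ := hx
    have hdense : Dense (Ω : Set X) := Ω.2.dense ⟨ω.1, ω.2⟩
    haveI : IsDominant (X.homOfLE hΩW) := AlgebraicGeometry.Opens.isDominant_homOfLE hdense hΩW
    refine ext_of_isDominant_of_isSeparated h ?_ (X.homOfLE hΩW) ?_
    · rw [Category.assoc, ← hjdef, hℓ]
    · have hid : X.homOfLE hΩW ≫ ℓ = 𝟙 _ := by
        rw [← cancel_mono j, Category.assoc, hℓ, Category.id_comp, ← Category.assoc, Scheme.homOfLE_ι]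
      rw [Scheme.homOfLE_ι, ← Category.assoc, hid, Category.id_comp]
  have key : (W.ι).base ⟨x, hxW⟩ = (ℓ ≫ Ω.ι).base ⟨x, hxW⟩ := by rw [heq]
  rw [Scheme.Hom.comp_base, TopCat.comp_app] at key
  have hxeq : x = (ℓ.base ⟨x, hxW⟩).1 := key
  rw [hxeq]
  exact (ℓ.base ⟨x, hxW⟩).2

/-- **One surjective stalk map on a fibre of a birational morphism onto a normal scheme makes all stalk maps on that
fibre isomorphisms.**  Let `h : X → Y` be separated of finite type and birational between integral schemes, `Y` with
integrally closed local rings, and `x, x'` two points of the same fibre with `h♯_{x'}` surjective.  Then `h` is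
quasi-finite at `x'`, so (Zariski's Main Theorem, tree `exists_isOpenImmersion_of_quasiFiniteAt`) an open `Ω ∋ x'` maps
isomorphically onto an open of `Y`; by saturation `x ∈ Ω`, so `h♯_x` is an isomorphism. [cite: StacksProject, Tag 03GW] -/
theorem isIso_stalkMap_of_surjective_stalkMap_of_base_eq [IsIntegral X] [IsIntegral Y] (h : X ⟶ Y)
    [IsSeparated h] [LocallyOfFiniteType h] [QuasiCompact h] (hbir : IsBirational h)
    (hY : ∀ y : Y, IsIntegrallyClosed (Y.presheaf.stalk y)) {x x' : X}
    (hx' : Function.Surjective (h.stalkMap x')) (hxx' : h.base x = h.base x') : IsIso (h.stalkMap x) := by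
  have hq : h.QuasiFiniteAt x' := RingHom.QuasiFinite.of_finite (RingHom.Finite.of_surjective _ hx')
  obtain ⟨Ω, hx'Ω, hΩ⟩ :=
    exists_isOpenImmersion_of_quasiFiniteAt h hbir ⊤ (fun y _ => hY y) (Opens.mem_top _) hq
  haveI := hΩ
  have hxΩ : x ∈ Ω :=
    mem_of_isOpenImmersion_ι_comp h Ω ⟨⟨x', hx'Ω⟩, by rw [Scheme.Hom.comp_base, TopCat.comp_app, hxx']; rfl⟩
  have h1 : IsIso ((Ω.ι ≫ h).stalkMap ⟨x, hxΩ⟩) := inferInstance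
  rw [Scheme.Hom.stalkMap_comp] at h1
  have h2 : IsIso (Ω.ι.stalkMap ⟨x, hxΩ⟩) := inferInstance
  exact @IsIso.of_isIso_comp_right _ _ _ _ _ _ _ h2 h1

/-- **A valuation ring is maximal for domination, stalk form**: for `h : X → Y` birational between integral schemes and
a point `ξ` whose image has a valuation ring `𝒪_{Y,h ξ}` for local ring, `h♯_ξ : 𝒪_{Y,h ξ} → 𝒪_{X,ξ}` is surjective
(the tree's `surjective_of_valuationRing_of_fac` applied to the square `𝒪_{Y,h ξ} → K(Y) ↠ K(X) ← 𝒪_{X,ξ}`; the argument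
of `bijective_stalkMap_of_fac`, freed of the exceptional-curve hypothesis). [folklore] -/
theorem surjective_stalkMap_of_valuationRing [IsIntegral X] [IsIntegral Y] (h : X ⟶ Y) (hbir : IsBirational h)
    (ξ : X) [ValuationRing (Y.presheaf.stalk (h.base ξ))] : Function.Surjective (h.stalkMap ξ) := by
  haveI : IsDominant h := hbir.isDominant
  have hgen : h.base (genericPoint X) = genericPoint Y := RatFn.genericPoint_eq_of_isDominant h
  have hsp' : h.base (genericPoint X) ⤳ genericPoint Y := by rw [hgen]
  have hsp : genericPoint Y ⤳ h.base (genericPoint X) := genericPoint_specializes _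
  let ψ : Y.functionField →+* X.functionField :=
    (h.stalkMap (genericPoint X)).hom.comp (Y.presheaf.stalkSpecializes hsp').hom
  have hψ : Function.Surjective ψ := by
    haveI : IsIso (h.stalkMap (genericPoint X)) := hbir.isIso_stalkMap_genericPoint
    refine (ConcreteCategory.bijective_of_isIso (h.stalkMap (genericPoint X))).2.comp ?_
    refine Function.RightInverse.surjective (g := (Y.presheaf.stalkSpecializes hsp).hom) fun y => ?_
    change (Y.presheaf.stalkSpecializes hsp ≫ Y.presheaf.stalkSpecializes hsp') y = y
    rw [TopCat.Presheaf.stalkSpecializes_comp]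
    have : Y.presheaf.stalkSpecializes (hsp'.trans hsp) = 𝟙 _ :=
      TopCat.Presheaf.stalkSpecializes_refl _ _
    rw [this]; rfl
  have hsq : ∀ a : Y.presheaf.stalk (h.base ξ),
      ψ (algebraMap (Y.presheaf.stalk (h.base ξ)) Y.functionField a) =
        algebraMap (X.presheaf.stalk ξ) X.functionField ((h.stalkMap ξ).hom a) := by
    intro a
    have gX : genericPoint X ⤳ ξ := genericPoint_specializes ξ
    change (h.stalkMap (genericPoint X)).hom ((Y.presheaf.stalkSpecializes hsp').hom
        ((Y.presheaf.stalkSpecializes (genericPoint_specializes (h.base ξ))).hom a)) =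
      (X.presheaf.stalkSpecializes gX).hom ((h.stalkMap ξ).hom a)
    rw [← CommRingCat.comp_apply (Y.presheaf.stalkSpecializes _) (Y.presheaf.stalkSpecializes hsp'),
      TopCat.Presheaf.stalkSpecializes_comp]
    exact Scheme.Hom.stalkSpecializes_stalkMap_apply h (genericPoint X) ξ gX a
  have hBK : Function.Injective (algebraMap (X.presheaf.stalk ξ) X.functionField) :=
    IsFractionRing.injective (X.presheaf.stalk ξ) X.functionField
  exact surjective_of_valuationRing_of_fac hBK (h.stalkMap ξ).hom ψ hψ hsq

end Saturation

/-! ## §2 A point which is minimal for the specialisation preorder is closed -/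

/-- A point of height `0` in the specialisation order of a scheme is a closed point (universe-polymorphic copy of
`NoZeno.ExcCount.isClosed_singleton_of_height_eq_zero`). [folklore] -/
theorem isClosed_singleton_of_height_eq_zero' {Z : Scheme.{u}} {z : Z} (hz : Order.height z = 0) :
    IsClosed ({z} : Set Z) := by
  rw [Order.height_eq_zero] at hz
  rw [← closure_subset_iff_isClosed]
  intro x hx
  have hzx : z ⤳ x := specializes_iff_mem_closure.mpr hx
  have hle : x ≤ z := Scheme.le_iff_specializes.mpr hzx
  have hxz : x ⤳ z := Scheme.le_iff_specializes.mp (hz hle)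
  exact (hxz.antisymm hzx).eq

/-! ## §3 The non-isomorphism locus of a morphism between desingularizations -/

section NonIso

variable {S : Type u} [CommRing S] [IsNoetherianRing S] [IsLocalRing S] [IsDomain S] [IsIntegrallyClosed S]
  {X Y : Scheme.{u}} {ρ : Y ⟶ Spec (.of S)} {h : X ⟶ Y}

/-- **The non-isomorphism locus (Brick (i) of the first-kind clause (F)).**  `S` a two-dimensional Noetherian local
normal domain, `ρ : Y → Spec S` and `h ≫ ρ : X → Spec S` desingularizations, `h` not an isomorphism.  Then there is a
closed point `y ∈ Y` over the closed point of `S` with `dim 𝒪_{Y,y} = 2`, NO point of `h⁻¹(y)` having surjective `h♯`,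
`𝔪_y·𝒪_X ≠ 0`, and some integral exceptional curve of `h ≫ ρ` contracted onto `y`.
[cite: StacksProject, Tag 0C5R (proof: "there exists a closed point y ∈ Y such that … is not an isomorphism")];
[cite: EGAIV4, 21.12.12] -/
theorem exists_closedPoint_of_not_isIso (h2 : ringKrullDim S = 2) (hπ : IsResolution (h ≫ ρ))
    (hρ : IsResolution ρ) (hh : ¬ IsIso h) :
    ∃ (y : Y) (hy : IsClosed ({y} : Set Y)), ρ.base y = closedPoint S ∧
      ringKrullDim (Y.presheaf.stalk y) = 2 ∧
      (∀ x : X, h.base x = y → ¬ Function.Surjective (h.stalkMap x)) ∧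
      (vanishingIdeal ⟨{y}, hy⟩).comap h ≠ ⊥ ∧
      ∃ η ∈ excCurvePoints (h ≫ ρ), h.base η = y := by
  haveI : IsIntegral Y := hρ.isIntegral_source
  haveI : IsIntegral X := hπ.isIntegral_source
  haveI : IsProper ρ := hρ.isProper
  haveI : IsProper (h ≫ ρ) := hπ.isProper
  haveI : IsProper h := IsProper.of_comp h ρ
  have hbir : IsBirational h := isBirational_of_fac hπ.isBirational hρ.isBirational
  haveI : IsDominant h := hbir.isDominant
  haveI : IsLocallyNoetherian X := LocallyOfFiniteType.isLocallyNoetherian (h ≫ ρ)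
  haveI : IsLocallyNoetherian Y := LocallyOfFiniteType.isLocallyNoetherian ρ
  haveI : IsNoetherian Y := by
    haveI : CompactSpace Y := QuasiCompact.compactSpace_of_compactSpace ρ
    exact {}
  have hYreg : ∀ y : Y, IsRegularLocalRing (Y.presheaf.stalk y) := hρ.isRegular
  have hYnorm : ∀ y : Y, IsIntegrallyClosed (Y.presheaf.stalk y) := fun y => by
    haveI := isDomain_of_isRegularLocalRing (Y.presheaf.stalk y)
    haveI := uniqueFactorizationMonoid_of_isRegularLocalRing (Y.presheaf.stalk y) (hYreg y)
    infer_instance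
  -- Step A (purity): an exceptional point in codimension `≤ 1`
  have hA : ∃ x : X, ringKrullDim (X.presheaf.stalk x) ≤ 1 ∧ ¬ Function.Surjective (h.stalkMap x) := by
    by_contra hcon
    push Not at hcon
    exact hh (isIso_of_isProper_of_isBirational_of_forall_ringKrullDim_le_one h hbir hYreg hcon)
  obtain ⟨x, hx1, hxns⟩ := hA
  -- Step B: `dim 𝒪_{Y,h x} = 2` (a DVR or field would be dominated, hence equal)
  have hdimY : ∀ y : Y, ringKrullDim (Y.presheaf.stalk y) ≤ 2 := fun y =>
    ringKrullDim_stalk_le_two_of_isBirational h2.le ρ hρ.isBirational y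
  have hy2 : ringKrullDim (Y.presheaf.stalk (h.base x)) = 2 := by
    by_contra hne
    have hle1 := Lipman12B.withBot_enat_le_one_of_lt_two (lt_of_le_of_ne (hdimY _) hne)
    haveI := hYreg (h.base x)
    haveI := isPrincipalIdealRing_of_ringKrullDim_le_one (R := Y.presheaf.stalk (h.base x)) hle1
    haveI : ValuationRing (Y.presheaf.stalk (h.base x)) := inferInstance
    exact hxns (surjective_stalkMap_of_valuationRing h hbir x)
  -- Step C: `h x` is closed and lies over the closed point
  obtain ⟨hycl, hy𝔪⟩ := isClosed_singleton_of_ringKrullDim_stalk_eq_two ρ hdimY hy2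
  refine ⟨h.base x, hycl, hy𝔪, hy2, fun x' hx' hsurj => ?_, fun hbot => ?_, ⟨x, ?_, rfl⟩⟩
  · -- Step D: no point of the fibre has surjective `h♯`
    haveI := isIso_stalkMap_of_surjective_stalkMap_of_base_eq h hbir hYnorm hsurj hx'.symm
    exact hxns (ConcreteCategory.bijective_of_isIso (h.stalkMap x)).2
  · -- Step E: `𝔪_y·𝒪_X ≠ 0`
    have hst : stalkIdeal ((vanishingIdeal ⟨{h.base x}, hycl⟩).comap h) x = ⊥ := by
      obtain ⟨U, hU, hxU, -⟩ :=
        exists_isAffineOpen_mem_and_subset (X := X) (x := x) (U := ⊤) (Opens.mem_top x)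
      rw [hbot, stalkIdeal_eq_map_germ ⊥ ⟨U, hU⟩ hxU, Scheme.IdealSheafData.ideal_bot, Pi.bot_apply,
        Ideal.map_bot]
    rw [stalkIdeal_comap_eq_map_stalkMap, stalkIdeal_vanishingIdeal_singleton hycl] at hst
    have hinj := stalkMap_injective_of_isDominant h x
    have hm : maximalIdeal (Y.presheaf.stalk (h.base x)) = ⊥ := by
      refine le_bot_iff.mp fun t ht => ?_
      have hmt : (h.stalkMap x).hom t ∈ (maximalIdeal (Y.presheaf.stalk (h.base x))).map (h.stalkMap x).hom :=
        Ideal.mem_map_of_mem _ ht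
      rw [hst, Ideal.mem_bot] at hmt
      exact hinj (by rw [hmt, map_zero])
    have hfield : IsField (Y.presheaf.stalk (h.base x)) := (IsLocalRing.isField_iff_maximalIdeal_eq).mpr hm
    have h0 := ringKrullDim_eq_zero_of_isField hfield
    rw [hy2] at h0
    exact absurd h0 (by decide)
  · -- Step F: `x` is the generic point of an integral exceptional curve of `h ≫ ρ`
    have hx𝔪 : (h ≫ ρ).base x = closedPoint S := by
      rw [Scheme.Hom.comp_base, TopCat.comp_app]; exact hy𝔪
    refine ⟨hx𝔪, le_antisymm (hπ.height_le_one_of_base_eq_closedPoint h2 hx𝔪) ?_⟩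
    refine Order.one_le_iff_ne_zero.mpr fun h0 => ?_
    have hxcl : IsClosed ({x} : Set X) := isClosed_singleton_of_height_eq_zero' h0
    -- `h ≫ ρ` has an exceptional curve: otherwise it is an isomorphism and `h♯_x` is onto
    have hne : (excCurvePoints (h ≫ ρ)).Nonempty := by
      by_contra hemp
      rw [Set.not_nonempty_iff_eq_empty] at hemp
      haveI := hπ.isIso_of_closedFibre_subsingleton
        (hπ.closedFibre_subsingleton_of_excCurvePoints_eq_empty h2 hemp)
      apply hxns
      have hbij := (ConcreteCategory.bijective_of_isIso ((h ≫ ρ).stalkMap x)).2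
      rw [Scheme.Hom.stalkMap_comp] at hbij
      intro b
      obtain ⟨a, ha⟩ := hbij b
      exact ⟨(ρ.stalkMap (h.base x)).hom a, ha⟩
    have h2x := hπ.ringKrullDim_stalk_eq_two_of_isClosed_of_nonempty h2 hne hx𝔪 hxcl
    rw [h2x] at hx1
    exact absurd hx1 (by decide)

/-- **`π = h ≫ ρ` form with the regularity facts FactorStep′ wants**: under the same hypotheses, the closed point `y`
comes with `𝒪_{Y,y}` regular of dimension `2` and every point of `X` has a regular local ring of dimension `≤ 2`.
[cite: StacksProject, Tag 0C5R] -/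
theorem exists_fac_blowup_point_of_not_isIso (h2 : ringKrullDim S = 2) (hπ : IsResolution (h ≫ ρ))
    (hρ : IsResolution ρ) (hh : ¬ IsIso h) :
    ∃ (y : Y) (hy : IsClosed ({y} : Set Y)), ρ.base y = closedPoint S ∧
      ringKrullDim (Y.presheaf.stalk y) = 2 ∧
      (∃ η ∈ excCurvePoints (h ≫ ρ), h.base η = y) ∧
      ∀ ⦃Y' : Scheme.{u}⦄ ⦃b : Y' ⟶ Y⦄, IsBlowup b (vanishingIdeal ⟨{y}, hy⟩) → ∃ h' : X ⟶ Y', h' ≫ b = h := by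
  obtain ⟨y, hy, hy𝔪, hy2, hns, hne, hη⟩ := exists_closedPoint_of_not_isIso h2 hπ hρ hh
  haveI : IsIntegral Y := hρ.isIntegral_source
  haveI : IsIntegral X := hπ.isIntegral_source
  haveI : IsProper (h ≫ ρ) := hπ.isProper
  have hbir : IsBirational h := isBirational_of_fac hπ.isBirational hρ.isBirational
  haveI : IsDominant h := hbir.isDominant
  haveI : IsLocallyNoetherian X := LocallyOfFiniteType.isLocallyNoetherian (h ≫ ρ)
  haveI : IsNoetherian X := by
    haveI : CompactSpace X := QuasiCompact.compactSpace_of_compactSpace (h ≫ ρ)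
    exact {}
  haveI : IsRegularLocalRing (Y.presheaf.stalk y) := hρ.isRegular y
  have hX : ∀ x : X, h.base x = y →
      IsRegularLocalRing (X.presheaf.stalk x) ∧ ringKrullDim (X.presheaf.stalk x) ≤ 2 := fun x _ =>
    ⟨hπ.isRegular x, ringKrullDim_stalk_le_two_of_isBirational h2.le (h ≫ ρ) hπ.isBirational x⟩
  exact ⟨y, hy, hy𝔪, hy2, hη, fun Y' b hb =>
    Lipman12B.exists_fac_blowup_point_of_forall_not_surjective' h hbir hy hy2 hX hns hne hb⟩

end NonIso

end Summit.ResolutionOfSingularities.ResolutionOfSingularities.Theorems.NoZeno.FirstKind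

end
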